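import Summits.BirchSwinnertonDyer.BirchSwinnertonDyer.Theorems.PrintCf2SplitBadTwoLocalControlKernelDichotomy
import Summits.BirchSwinnertonDyer.BirchSwinnertonDyer.Theorems.PrintCf2SplitBadTwoCMPrimaryLocalFixedPoints
import Mathlib.Data.ZMod.QuotientGroup
import HarnessLib

/-!
# Crux `PrintCf2.SplitBadTwoRankOneOfFacts` (stmt-BirchSwinnertonDyer-20368), road α v10.2 — brick B15 file 2: the DYADIC DICHOTOMY for
# `W* = E[𝔮_ρ^∞]` — `LK_{v̄} = 0` if `ker κ' ⊓ D_{v̄}` fixes `W*`; `#LK_{v̄} ≤ 2` if it moves `W*[4]` (every `ℤ₂`-line, no CFT inside)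

Cell `bsd-print-cf2`, width seat `bsd-line-cf2-p1-w2` g9 (prover-bsd-line-cf2-p1-w2-g9-0); brick B15 (memo
`Cruxes/SplitBadTwoRankOneOfFacts/B15-DYADIC-EXACT-w2g9.md` §3); `--supports stmt-BirchSwinnertonDyer-20368` (helper, Theses-free). HONEST
FRAMING: nothing here closes the crux or a registered stub; BSD is not proved by any of this; no summit statement is proved by this seat. No
definition, no named fact, no `sorry`. Sequel of file 1 (`…LocalControlKernelDichotomy`, the generic engine) — this file supplies the
`W*`-side inputs from the COCYCLIC structure of the CM summand (p646843 `endEigenPrimaryTorsion_two_structure`: `#C[2^k] = 2^k`, `C[2^k]` cyclic).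

* §1 (`CMPrimes`, `W/ℚ` with `j = −3375`, `L ∋ θ`, `θ² = −7`, `π² = π − 2`, `ρ` either root, `C := E[𝔮_ρ^∞]`):
  `zmultiples_eq_inf_torsionBy_of_addOrderOf_eq` (an element of order `2^j` generates `C[2^j]`), `exists_addOrderOf_eq_two_pow`,
  **`eq_of_le_of_infinite`** (`C` is COCYCLIC: every infinite subgroup of `C` is `C`), `not_finite_endEigenPrimaryTorsion`,
  **`exists_smul_sub_eq_of_smul_ne`** (an element of `Γ_L` moving a point of `C` has `σ − 1` ONTO `C`: its image is an infinite subgroup),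
  **`two_nsmul_eq_zero_of_fixed_of_smul_ne`** (if some `σ ∈ S` moves a point of `C[4]`, every point fixed by `S` lies in `C[2]`).
* §2 (`RestrictedSelmerPair`, the local kernel `LK_w := ker (H¹(⊤ ⊓ D_w, W*) → H¹(ker κ ⊓ D_w, W*))` of `relIndex_le_prod_natCard_localKer`):
  **`natCard_localKer_top_le_two_of_exists_smul_ne`** — at ANY finite place `w`, for ANY `ℤ₂`-line `κ`: if some `σ ∈ ker κ ⊓ D_w` moves a point of
  `W*[4]`, then `LK_w` is finite with `#LK_w ≤ 2` (file 1 (b) with `A ⊆ W*[2]`); **`localKer_top_eq_bot_of_smul_eq_of_above_two`** — at a place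
  `w ∈ {v, v̄}` above `2` of a quadratic `K ∋ √−7`: if `ker κ ⊓ D_w` fixes `W*` pointwise then `LK_w = ⊥` (file 1 (a): `δ − 1` onto by §1, and `D_w`
  moves a point of `W*` by p656168); frame versions at the strict place `v̄`, θ-free: `natCard_localKer_vbar_le_two_of_frame`,
  `localKer_vbar_eq_bot_of_frame`. With the class-field-theoretic shape `ker κ' ⊓ D_{v̄} = ψ^{-1}(±1)` (memo (C3)) exactly one hypothesis
  holds, by `[d]₂`: `LK_{v̄} = 0` iff `d ≡ 3 (8)` or `d ≡ 14 (16)`, else `ℤ/2` — the dyadic unit of S3c₂'s `eC`; that CFT input is NOT claimed here.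
presearch: Greenberg LNM 1716 §3 (Lemma 3.1: `H¹(Γ, B) = B/(γ−1)B`; p. 87), Rubin LNM 1716 §2 / Prop. 5.4 (`E[𝔭^∞] ≅ K_𝔭/𝓞_𝔭`), Agboola 2007
§3 Prop. 3.2 — held; tree: p659525 (`#LK ≤ #W*(K_w) ≤ 4`), file 1. beyond-print theorem: no.

References: [GreenbergLNM1716] §3 Lemma 3.1, p. 87; [Rubin1999] §2, Prop. 5.4; [Agboola2007] §3 Prop. 3.2; [SilvermanATAEC1994] II §1.
-/

noncomputable section

open scoped Classical

set_option linter.dupNamespace false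
set_option autoImplicit false

universe u

/-! ## §1. The CM summand `C = E[𝔮_ρ^∞]` is cocyclic: consequences -/

namespace Summit.BirchSwinnertonDyer.BirchSwinnertonDyer.Theorems.PrintCf2.CMPrimes

section Cocyclic

open WeierstrassCurve Literature.NumberTheory.EllipticCurves Field NumberField

variable (W : WeierstrassCurve ℚ) [W.IsElliptic] (L : Type) [Field L] [NumberField L]

/-- **An element of order `2^j` of `C = E[𝔮_ρ^∞]` generates `C[2^j]`** (`C[2^j]` has `2^j` elements and contains `ℤ·y`).
[cite: Rubin1999, §2 and Prop. 5.4] -/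
theorem zmultiples_eq_inf_torsionBy_of_addOrderOf_eq (hj : W.j = -3375) {θ : L} (hθ : θ ^ 2 = -7)
    (π : (W.baseChange L).endRing) (hrel : (π : AddMonoid.End (W.baseChange L).geomPoints) * π = π - 2)
    {ρ : ℤ_[2]} (hρ : ρ * ρ = ρ - 2) {y : (W.baseChange L).geomPrimaryTorsion 2}
    (hy : y ∈ (W.baseChange L).endEigenPrimaryTorsion 2 π ρ) {j : ℕ} (hord : addOrderOf y = 2 ^ j) :
    AddSubgroup.zmultiples y = (W.baseChange L).endEigenPrimaryTorsion 2 π ρ ⊓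
      AddSubgroup.torsionBy ((W.baseChange L).geomPrimaryTorsion 2) (2 ^ j : ℕ) := by
  obtain ⟨-, -, -, -, -, hcard, -, -⟩ := endEigenPrimaryTorsion_two_structure W hj L hθ π hrel hρ
  have hle : AddSubgroup.zmultiples y ≤ (W.baseChange L).endEigenPrimaryTorsion 2 π ρ ⊓
      AddSubgroup.torsionBy ((W.baseChange L).geomPrimaryTorsion 2) (2 ^ j : ℕ) := by
    rw [AddSubgroup.zmultiples_le]
    exact ⟨hy, AddSubgroup.torsionBy.nsmul_iff.mpr (hord ▸ addOrderOf_nsmul_eq_zero y)⟩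
  haveI : Finite ↥((W.baseChange L).endEigenPrimaryTorsion 2 π ρ ⊓
      AddSubgroup.torsionBy ((W.baseChange L).geomPrimaryTorsion 2) (2 ^ j : ℕ)) :=
    Nat.finite_of_card_ne_zero (by rw [hcard j]; exact pow_ne_zero _ two_ne_zero)
  exact AddSubgroup.eq_of_le_of_card_ge hle (by rw [hcard j, Nat.card_zmultiples, hord])

omit [W.IsElliptic] in
/-- Every element of the `2`-primary group `E_L[2^∞]` has order a power of `2`. [folklore] -/
theorem exists_addOrderOf_eq_two_pow (x : (W.baseChange L).geomPrimaryTorsion 2) : ∃ j : ℕ, addOrderOf x = 2 ^ j := by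
  haveI : Fact (Nat.Prime 2) := ⟨Nat.prime_two⟩
  obtain ⟨k, hk⟩ := (AddCommGroup.mem_primaryComponent).mp x.2
  have hxk : 2 ^ k • x = 0 := Subtype.ext (by rw [AddSubmonoidClass.coe_nsmul, ZeroMemClass.coe_zero]; exact hk)
  obtain ⟨j, -, hj⟩ := (Nat.dvd_prime_pow Nat.prime_two).mp (addOrderOf_dvd_of_nsmul_eq_zero hxk)
  exact ⟨j, hj⟩

/-- **`C = E[𝔮_ρ^∞]` is COCYCLIC: every INFINITE subgroup `B ≤ C` is all of `C`** (`B` contains elements of unbounded `2`-power order,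
each generating the corresponding level `C[2^j]`, and `C = ⋃ C[2^k]`). (`C ≅ ℚ₂/ℤ₂`, Rubin: `E[𝔭^∞] ≅ K_𝔭/𝓞_𝔭`.) [cite: Rubin1999, §2 and Prop. 5.4] -/
theorem eq_of_le_of_infinite (hj : W.j = -3375) {θ : L} (hθ : θ ^ 2 = -7)
    (π : (W.baseChange L).endRing) (hrel : (π : AddMonoid.End (W.baseChange L).geomPoints) * π = π - 2)
    {ρ : ℤ_[2]} (hρ : ρ * ρ = ρ - 2) {B : AddSubgroup ((W.baseChange L).geomPrimaryTorsion 2)}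
    (hB : B ≤ (W.baseChange L).endEigenPrimaryTorsion 2 π ρ) (hinf : ¬ Finite ↥B) :
    B = (W.baseChange L).endEigenPrimaryTorsion 2 π ρ := by
  set C := (W.baseChange L).endEigenPrimaryTorsion 2 π ρ with hC_def
  obtain ⟨-, -, -, -, -, hcard, -, -⟩ := endEigenPrimaryTorsion_two_structure W hj L hθ π hrel hρ
  refine le_antisymm hB fun x hx ↦ ?_
  -- `x ∈ C[2^k]` for some `k`
  obtain ⟨k, hk⟩ := (AddCommGroup.mem_primaryComponent).mp x.2
  have hxk : 2 ^ k • x = 0 := Subtype.ext (by rw [AddSubmonoidClass.coe_nsmul, ZeroMemClass.coe_zero]; exact hk)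
  -- `B` has an element `y` with `2^k • y ≠ 0`
  have hy : ∃ y ∈ B, 2 ^ k • y ≠ 0 := by
    by_contra h
    push Not at h
    have hBle : B ≤ C ⊓ AddSubgroup.torsionBy ((W.baseChange L).geomPrimaryTorsion 2) (2 ^ k : ℕ) :=
      fun y hy ↦ ⟨hB hy, AddSubgroup.torsionBy.nsmul_iff.mpr (h y hy)⟩
    haveI : Finite ↥(C ⊓ AddSubgroup.torsionBy ((W.baseChange L).geomPrimaryTorsion 2) (2 ^ k : ℕ)) :=
      Nat.finite_of_card_ne_zero (by rw [hcard k]; exact pow_ne_zero _ two_ne_zero)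
    exact hinf (Finite.of_injective _ (AddSubgroup.inclusion_injective hBle))
  obtain ⟨y, hyB, hyk⟩ := hy
  obtain ⟨j, hj'⟩ := exists_addOrderOf_eq_two_pow W L y
  -- `j > k`, so `C[2^k] ≤ C[2^j] = ℤ·y ≤ B`
  have hjk : k ≤ j := by
    by_contra hlt
    push Not at hlt
    apply hyk
    obtain ⟨e, he⟩ := Nat.exists_eq_add_of_le hlt.le
    rw [he, pow_add, mul_comm, mul_smul, ← hj', addOrderOf_nsmul_eq_zero, smul_zero]
  have hzm := zmultiples_eq_inf_torsionBy_of_addOrderOf_eq W L hj hθ π hrel hρ (hB hyB) hj'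
  have hxj : x ∈ C ⊓ AddSubgroup.torsionBy ((W.baseChange L).geomPrimaryTorsion 2) (2 ^ j : ℕ) := by
    refine ⟨hx, AddSubgroup.torsionBy.nsmul_iff.mpr ?_⟩
    obtain ⟨e, he⟩ := Nat.exists_eq_add_of_le hjk
    rw [he, pow_add, mul_comm, mul_smul, hxk, smul_zero]
  rw [← hzm] at hxj
  exact (AddSubgroup.zmultiples_le.mpr hyB) hxj

/-- `C = E[𝔮_ρ^∞]` is INFINITE (`#C[2^k] = 2^k` for every `k`). [cite: Rubin1999, §2 and Prop. 5.4] -/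
theorem not_finite_endEigenPrimaryTorsion (hj : W.j = -3375) {θ : L} (hθ : θ ^ 2 = -7)
    (π : (W.baseChange L).endRing) (hrel : (π : AddMonoid.End (W.baseChange L).geomPoints) * π = π - 2)
    {ρ : ℤ_[2]} (hρ : ρ * ρ = ρ - 2) : ¬ Finite ↥((W.baseChange L).endEigenPrimaryTorsion 2 π ρ) := by
  intro hfin
  set C := (W.baseChange L).endEigenPrimaryTorsion 2 π ρ with hC_def
  obtain ⟨-, -, -, -, -, hcard, -, -⟩ := endEigenPrimaryTorsion_two_structure W hj L hθ π hrel hρ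
  -- `2^n ≤ #C` for all `n`, absurd for `n = #C`
  have hle : ∀ n : ℕ, 2 ^ n ≤ Nat.card ↥C := fun n ↦ by
    rw [← hcard n]
    exact Nat.card_le_card_of_injective _ (AddSubgroup.inclusion_injective
      (inf_le_left : C ⊓ AddSubgroup.torsionBy ((W.baseChange L).geomPrimaryTorsion 2) (2 ^ n : ℕ) ≤ C))
  exact absurd (hle (Nat.card ↥C)) (not_le.mpr (Nat.lt_two_pow_self))

/-- **An element of `Γ_L` that moves a point of `C` has `σ − 1` ONTO `C`.** The image of `σ − 1` on `C` is a subgroup of `C`; its kernel (the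
points fixed by `σ`) is a PROPER subgroup, hence finite (cocyclic), so the image is infinite (`C` is infinite), hence all of `C`. Greenberg:
"`(γ − 1)B = B` for `B` divisible on which `γ` acts by a non-trivial scalar". [cite: GreenbergLNM1716, §3 Lemma 3.1 and p. 87] -/
theorem exists_smul_sub_eq_of_smul_ne (hj : W.j = -3375) {θ : L} (hθ : θ ^ 2 = -7)
    (π : (W.baseChange L).endRing) (hrel : (π : AddMonoid.End (W.baseChange L).geomPoints) * π = π - 2)
    {ρ : ℤ_[2]} (hρ : ρ * ρ = ρ - 2) (σ : absoluteGaloisGroup L)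
    (hσ : ∃ x ∈ (W.baseChange L).endEigenPrimaryTorsion 2 π ρ, σ • x ≠ x) :
    ∀ z ∈ (W.baseChange L).endEigenPrimaryTorsion 2 π ρ, ∃ y ∈ (W.baseChange L).endEigenPrimaryTorsion 2 π ρ, σ • y - y = z := by
  set C := (W.baseChange L).endEigenPrimaryTorsion 2 π ρ with hC_def
  -- `φ = σ − 1` on the module `↥C`
  let φ : ↥C →+ ↥C := (DistribSMul.toAddMonoidHom ↥C σ) - AddMonoidHom.id ↥C
  have hφ : ∀ y : ↥C, ((φ y : ↥C) : (W.baseChange L).geomPrimaryTorsion 2) = σ • (y : (W.baseChange L).geomPrimaryTorsion 2) - y :=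
    fun y ↦ rfl
  -- the kernel is finite (a proper subgroup of the cocyclic `C`)
  have hker : Finite φ.ker := by
    by_contra hinf
    have hle : φ.ker.map C.subtype ≤ C := by
      rintro _ ⟨y, -, rfl⟩; exact y.2
    have hinf' : ¬ Finite ↥(φ.ker.map C.subtype) := fun h ↦
      hinf (Finite.of_equiv _ (AddSubgroup.equivMapOfInjective φ.ker C.subtype Subtype.val_injective).toEquiv.symm)
    have heq := eq_of_le_of_infinite W L hj hθ π hrel hρ hle hinf'
    obtain ⟨x, hx, hσx⟩ := hσ
    have hxm : x ∈ φ.ker.map C.subtype := by rw [heq]; exact hx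
    obtain ⟨y, hy, hyx⟩ := hxm
    apply hσx
    have h0 := congrArg (fun z : ↥C ↦ (z : (W.baseChange L).geomPrimaryTorsion 2)) ((AddMonoidHom.mem_ker).mp hy)
    simp only [hφ, ZeroMemClass.coe_zero] at h0
    rw [← hyx]
    exact sub_eq_zero.mp h0
  -- hence the range is infinite, hence everything
  have hrange : ¬ Finite φ.range := by
    intro hfin
    haveI := hfin
    haveI := hker
    haveI : Finite (↥C ⧸ φ.ker) := Finite.of_equiv _ (QuotientAddGroup.quotientKerEquivRange φ).toEquiv.symm
    have hC : Nat.card ↥C ≠ 0 := by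
      rw [φ.ker.card_eq_card_quotient_mul_card_addSubgroup]
      exact mul_ne_zero Nat.card_pos.ne' Nat.card_pos.ne'
    exact not_finite_endEigenPrimaryTorsion W L hj hθ π hrel hρ (Nat.finite_of_card_ne_zero hC)
  have hle : φ.range.map C.subtype ≤ C := by
    rintro _ ⟨y, -, rfl⟩; exact y.2
  have hinf' : ¬ Finite ↥(φ.range.map C.subtype) := fun h ↦
    hrange (Finite.of_equiv _ (AddSubgroup.equivMapOfInjective φ.range C.subtype Subtype.val_injective).toEquiv.symm)
  have heq := eq_of_le_of_infinite W L hj hθ π hrel hρ hle hinf'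
  intro z hz
  have hzm : z ∈ φ.range.map C.subtype := by rw [heq]; exact hz
  obtain ⟨_, ⟨y, rfl⟩, hyz⟩ := hzm
  exact ⟨(y : (W.baseChange L).geomPrimaryTorsion 2), y.2, by rw [← hφ]; exact hyz⟩

/-- **If some element of `S` moves a point of `C[4]`, every point of `C` fixed by all of `S` lies in `C[2]`.** A fixed point `y` with `2y ≠ 0`
has order `2^j`, `j ≥ 2`, and `ℤ·y = C[2^j] ⊇ C[4]` would consist of fixed points. [cite: Rubin1999, §2 and Prop. 5.4] -/
theorem two_nsmul_eq_zero_of_fixed_of_smul_ne (hj : W.j = -3375) {θ : L} (hθ : θ ^ 2 = -7)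
    (π : (W.baseChange L).endRing) (hrel : (π : AddMonoid.End (W.baseChange L).geomPoints) * π = π - 2)
    {ρ : ℤ_[2]} (hρ : ρ * ρ = ρ - 2) (S : Set (absoluteGaloisGroup L))
    (hS : ∃ σ ∈ S, ∃ x ∈ (W.baseChange L).endEigenPrimaryTorsion 2 π ρ, 4 • x = 0 ∧ σ • x ≠ x)
    {y : (W.baseChange L).geomPrimaryTorsion 2} (hy : y ∈ (W.baseChange L).endEigenPrimaryTorsion 2 π ρ)
    (hfix : ∀ σ ∈ S, σ • y = y) : 2 • y = 0 := by
  set C := (W.baseChange L).endEigenPrimaryTorsion 2 π ρ with hC_def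
  obtain ⟨σ, hσS, x, hx, hx4, hσx⟩ := hS
  by_contra h2
  obtain ⟨j, hj'⟩ := exists_addOrderOf_eq_two_pow W L y
  -- `j ≥ 2`
  have hj2 : 2 ≤ j := by
    by_contra hlt
    push Not at hlt
    apply h2
    have hdvd : addOrderOf y ∣ 2 := by
      rw [hj']
      exact Nat.pow_dvd_pow_iff_le_right'.mpr (by omega) |>.trans (by norm_num : 2 ^ 1 ∣ 2)
    exact addOrderOf_dvd_iff_nsmul_eq_zero.mp hdvd
  -- the subgroup of `S`-fixed points of `C`
  let B : AddSubgroup ((W.baseChange L).geomPrimaryTorsion 2) :=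
    { carrier := {z | z ∈ C ∧ ∀ τ ∈ S, τ • z = z}
      zero_mem' := ⟨C.zero_mem, fun τ _ ↦ smul_zero τ⟩
      add_mem' := fun {a b} ha hb ↦ ⟨C.add_mem ha.1 hb.1, fun τ hτ ↦ by rw [smul_add, ha.2 τ hτ, hb.2 τ hτ]⟩
      neg_mem' := fun {a} ha ↦ ⟨C.neg_mem ha.1, fun τ hτ ↦ by rw [smul_neg, ha.2 τ hτ]⟩ }
  have hyB : y ∈ B := ⟨hy, hfix⟩
  have hzm := zmultiples_eq_inf_torsionBy_of_addOrderOf_eq W L hj hθ π hrel hρ hy hj'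
  -- `x ∈ C[4] ≤ C[2^j] = ℤ·y ≤ B`
  have hx' : x ∈ C ⊓ AddSubgroup.torsionBy ((W.baseChange L).geomPrimaryTorsion 2) (2 ^ j : ℕ) := by
    refine ⟨hx, AddSubgroup.torsionBy.nsmul_iff.mpr ?_⟩
    obtain ⟨e, he⟩ := Nat.exists_eq_add_of_le hj2
    rw [he, pow_add, mul_comm, mul_smul, show (2 : ℕ) ^ 2 = 4 from rfl, hx4, smul_zero]
  rw [← hzm] at hx'
  have hxB : x ∈ B := (AddSubgroup.zmultiples_le.mpr hyB) hx'
  exact hσx (hxB.2 σ hσS)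

end Cocyclic

end Summit.BirchSwinnertonDyer.BirchSwinnertonDyer.Theorems.PrintCf2.CMPrimes

/-! ## §2. The dyadic dichotomy for the local kernel of control of `W*` -/

namespace Summit.BirchSwinnertonDyer.BirchSwinnertonDyer.Theorems.PrintCf2.RestrictedSelmerPair

section CM

open NumberField IsDedekindDomain Field WeierstrassCurve
open Literature.NumberTheory.EllipticCurves Literature.NumberTheory.EllipticCurves.GreenbergSelmer
open Literature.NumberTheory.GaloisRepresentations
open Summit.BirchSwinnertonDyer.BirchSwinnertonDyer.Theorems.PrintCf2.AdditiveAtSeven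

variable (W : WeierstrassCurve ℚ) [W.IsElliptic] {K : Type} [Field K] [NumberField K]

/-- **`#LK_w ≤ 2` WHEN `ker κ ⊓ D_w` MOVES A POINT OF `W*[4]`** — at ANY finite place `w`, for ANY `ℤ₂`-line `κ` of a number field `K ∋ θ`, `θ² = −7`
(`j = −3375`, `π² = π − 2` in `End_K(E_K)`, `ρ` either root, `W* := ↥((W.baseChange K).endEigenPrimaryTorsion 2 π ρ)`): if some `σ ∈ ker κ ⊓ D_w` moves some
`x ∈ W*` with `4x = 0`, the `(ker κ ⊓ D_w)`-fixed module lies in `W*[2]` (§1), which has `2` elements, so the local kernel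
`LK_w = ker (H¹(⊤ ⊓ D_w, W*) → H¹(ker κ ⊓ D_w, W*))` is finite with `#LK_w ≤ 2` (file 1 (b)). At `w = v̄` this is the dyadic unit `v₂ #LK_{v̄} ≤ 1`.
[cite: GreenbergLNM1716, §3 Lemma 3.1 (p. 86)] [cite: Agboola2007, §3 Prop. 3.2] -/
theorem natCard_localKer_top_le_two_of_exists_smul_ne (hj : W.j = -3375) {θ : K} (hθ : θ ^ 2 = -7)
    (π : (W.baseChange K).endRing) (hrel : (π : AddMonoid.End (W.baseChange K).geomPoints) * π = π - 2)
    {ρ : ℤ_[2]} (hρ : ρ * ρ = ρ - 2) (w : HeightOneSpectrum (𝓞 K)) (κ : ZpExtension K 2)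
    (hmove : ∃ σ ∈ κ.kerSubgroup ⊓ decomp w, ∃ x : ↥((W.baseChange K).endEigenPrimaryTorsion 2 π ρ), 4 • x = 0 ∧ σ • x ≠ x) :
    Finite (resOfLe ↥((W.baseChange K).endEigenPrimaryTorsion 2 π ρ)
        (inf_le_inf_right (decomp w) (le_top : κ.kerSubgroup ≤ ⊤))).ker ∧
      Nat.card (resOfLe ↥((W.baseChange K).endEigenPrimaryTorsion 2 π ρ)
        (inf_le_inf_right (decomp w) (le_top : κ.kerSubgroup ≤ ⊤))).ker ≤ 2 := by
  set C := (W.baseChange K).endEigenPrimaryTorsion 2 π ρ with hC_def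
  obtain ⟨-, -, -, -, -, hcard, -, -⟩ := CMPrimes.endEigenPrimaryTorsion_two_structure W hj K hθ π hrel hρ
  -- the hypothesis in ambient currency
  have hS : ∃ σ ∈ ((κ.kerSubgroup ⊓ decomp w : Subgroup (absoluteGaloisGroup K)) : Set (absoluteGaloisGroup K)),
      ∃ x ∈ C, 4 • x = 0 ∧ σ • x ≠ x := by
    obtain ⟨σ, hσ, x, hx4, hσx⟩ := hmove
    refine ⟨σ, hσ, (x : (W.baseChange K).geomPrimaryTorsion 2), x.2, ?_, fun h ↦ hσx (Subtype.ext h)⟩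
    have := congrArg (fun z : ↥C ↦ (z : (W.baseChange K).geomPrimaryTorsion 2)) hx4
    simpa only [AddSubmonoidClass.coe_nsmul, ZeroMemClass.coe_zero] using this
  -- the fixed set lies in `C[2]`, which has two elements
  let T : Set ↥C := {m : ↥C | ∀ σ ∈ κ.kerSubgroup ⊓ decomp w, σ • m = m}
  haveI hfin2 : Finite ↥(C ⊓ AddSubgroup.torsionBy ((W.baseChange K).geomPrimaryTorsion 2) (2 ^ 1 : ℕ)) :=
    Nat.finite_of_card_ne_zero (by rw [hcard 1]; norm_num)
  let ι : T → ↥(C ⊓ AddSubgroup.torsionBy ((W.baseChange K).geomPrimaryTorsion 2) (2 ^ 1 : ℕ)) := fun m ↦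
    ⟨((m : ↥C) : (W.baseChange K).geomPrimaryTorsion 2), (m : ↥C).2, AddSubgroup.torsionBy.nsmul_iff.mpr (by
      rw [pow_one]
      exact CMPrimes.two_nsmul_eq_zero_of_fixed_of_smul_ne W K hj hθ π hrel hρ _ hS (m : ↥C).2
        (fun σ hσ ↦ congrArg Subtype.val (m.2 σ hσ)))⟩
  have hι : Function.Injective ι := by
    intro x y hxy
    apply Subtype.ext; apply Subtype.ext
    exact congrArg (fun z : ↥(C ⊓ AddSubgroup.torsionBy ((W.baseChange K).geomPrimaryTorsion 2) (2 ^ 1 : ℕ)) ↦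
      (z : (W.baseChange K).geomPrimaryTorsion 2)) hxy
  haveI : Finite T := Finite.of_injective ι hι
  have hT : Set.Finite T := Set.toFinite T
  have hT2 : Nat.card T ≤ 2 := by
    have h := Nat.card_le_card_of_injective ι hι
    rw [hcard 1, pow_one] at h
    exact h
  obtain ⟨hfin, hle⟩ := finite_localKer_top_and_card_le_of_finite_fixed κ ↥C w
    (continuous_smul_endEigenPrimaryTorsion (W.baseChange K) 2 π ρ) hT
  exact ⟨hfin, hle.trans hT2⟩

/-- **`LK_w = 0` WHEN `ker κ ⊓ D_w` FIXES `W*` POINTWISE, at the places above `2`.** `K` quadratic with `θ² = −7`, `w' ≠ w` the two places above `2`,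
`j = −3375`, `π² = π − 2`, `ρ` either root, `κ` ANY `ℤ₂`-line: if `ker κ ⊓ D_w` acts trivially on `W*`, then
`LK_w = ker (H¹(⊤ ⊓ D_w, W*) → H¹(ker κ ⊓ D_w, W*)) = ⊥` — file 1 (a) with `δ − 1` onto `W*` for every `δ` moving a point (§1) and `D_w` moving a point
(`H⁰(K_w, W*) ≤ W*[4]` for a suitable element, p656168, while `W*` has a point of order `8`). [cite: GreenbergLNM1716, §3 Lemma 3.1 and p. 87]
[cite: Agboola2007, §3 Prop. 3.2] -/
theorem localKer_top_eq_bot_of_smul_eq_of_above_two (hj : W.j = -3375) (hK2 : Module.finrank ℚ K = 2) {θ : K}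
    (hθ : θ ^ 2 = -7) (π : (W.baseChange K).endRing) (hrel : (π : AddMonoid.End (W.baseChange K).geomPoints) * π = π - 2)
    {ρ : ℤ_[2]} (hρ : ρ * ρ = ρ - 2) {w w' : HeightOneSpectrum (𝓞 K)} (hw : ((2 : ℕ) : 𝓞 K) ∈ w.asIdeal)
    (hw' : ((2 : ℕ) : 𝓞 K) ∈ w'.asIdeal) (hne : w' ≠ w) (κ : ZpExtension K 2)
    (htriv : ∀ σ ∈ κ.kerSubgroup ⊓ decomp w, ∀ x : ↥((W.baseChange K).endEigenPrimaryTorsion 2 π ρ), σ • x = x) :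
    (resOfLe ↥((W.baseChange K).endEigenPrimaryTorsion 2 π ρ)
        (inf_le_inf_right (decomp w) (le_top : κ.kerSubgroup ≤ ⊤))).ker = ⊥ := by
  set C := (W.baseChange K).endEigenPrimaryTorsion 2 π ρ with hC_def
  obtain ⟨-, -, -, -, -, -, hgen, -⟩ := CMPrimes.endEigenPrimaryTorsion_two_structure W hj K hθ π hrel hρ
  refine localKer_top_eq_bot_of_smul_eq_of_surjective κ ↥C w
    (continuous_smul_endEigenPrimaryTorsion (W.baseChange K) 2 π ρ) htriv ?_ ?_
  · -- `δ − 1` onto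
    rintro δ - ⟨m, hm⟩ z
    have hσ : ∃ x ∈ C, δ • x ≠ x :=
      ⟨(m : (W.baseChange K).geomPrimaryTorsion 2), m.2, fun h ↦ hm (Subtype.ext h)⟩
    obtain ⟨y, hy, hyz⟩ := CMPrimes.exists_smul_sub_eq_of_smul_ne W K hj hθ π hrel hρ δ hσ
      (z : (W.baseChange K).geomPrimaryTorsion 2) z.2
    exact ⟨⟨y, hy⟩, Subtype.ext hyz⟩
  · -- `D_w` moves a point of order `8`
    obtain ⟨δ, hδ, hδ4⟩ := CMPrimes.exists_mem_decomp_four_nsmul_eq_zero_of_smul_eq W K hj hK2 hθ π hrel hρ hw hw' hne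
    obtain ⟨g, hg, hord, -⟩ := hgen 3
    refine ⟨δ, hδ, ⟨g, hg⟩, fun h ↦ ?_⟩
    have h4 : 4 • g = 0 := hδ4 g hg (congrArg Subtype.val h)
    have hdvd : addOrderOf g ∣ 4 := addOrderOf_dvd_of_nsmul_eq_zero h4
    rw [hord] at hdvd
    exact absurd (Nat.le_of_dvd (by norm_num) hdvd) (by norm_num)

/-- **ROAD α, THE STRICT PLACE `v̄` — (Hv̄-move): `#LK_{v̄} ≤ 2`** on every S3c₂ frame (member `C • W = cm7^{(d)}`, `K` imaginary quadratic, `v̄ ≠ v`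
above `2`, `π² = π − 2` in `End_K(E_K)`, `r² = r − 2`, ANY `κ'`; no `θ`-binder), provided some element of `ker κ' ⊓ D_{v̄}` moves a point of `W*[4]`
(true for the CFT line iff `d ≢ 3 (8)` and `d ≢ 14 (16)`, memo (C3) — not claimed here). [cite: Agboola2007, §3 Prop. 3.2] -/
theorem natCard_localKer_vbar_le_two_of_frame {d : ℤ} (hd0 : d ≠ 0) (W : WeierstrassCurve ℚ) [W.IsElliptic]
    (C : VariableChange ℚ) (hC : C • W = cm7.quadraticTwist (d : ℚ))
    (vbar : HeightOneSpectrum (𝓞 K)) (π : (W.baseChange K).endRing)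
    (hrel : (π : AddMonoid.End (W.baseChange K).geomPoints) * π = π - 2) {r : ℤ_[2]} (hr : r * r = r - 2) (κ' : ZpExtension K 2)
    (hmove : ∃ σ ∈ κ'.kerSubgroup ⊓ decomp vbar, ∃ x : ↥((W.baseChange K).endEigenPrimaryTorsion 2 π r), 4 • x = 0 ∧ σ • x ≠ x) :
    Finite (resOfLe ↥((W.baseChange K).endEigenPrimaryTorsion 2 π r)
        (inf_le_inf_right (decomp vbar) (le_top : κ'.kerSubgroup ≤ ⊤))).ker ∧
      Nat.card (resOfLe ↥((W.baseChange K).endEigenPrimaryTorsion 2 π r)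
        (inf_le_inf_right (decomp vbar) (le_top : κ'.kerSubgroup ≤ ⊤))).ker ≤ 2 := by
  have hj : W.j = -3375 := j_eq_of_smul_eq_cm7Twist hd0 W C hC
  obtain ⟨θ, hθ⟩ := exists_sq_eq_neg_seven_of_cmEndo_mem_endRing W K hj π hrel
  exact natCard_localKer_top_le_two_of_exists_smul_ne W hj hθ π hrel hr vbar κ' hmove

/-- **ROAD α, THE STRICT PLACE `v̄` — (Hv̄-triv): `LK_{v̄} = 0`** on every S3c₂ frame (as above, ANY `κ'`, no `θ`-binder), provided `ker κ' ⊓ D_{v̄}` fixes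
`W*` pointwise (true for the CFT line iff `d ≡ 3 (8)` or `d ≡ 14 (16)`, memo (C3) — not claimed here): then the dyadic cokernel contribution to
S3c₂'s four-index identity VANISHES. [cite: Agboola2007, §3 Prop. 3.2] [cite: GreenbergLNM1716, §3 Lemma 3.1] -/
theorem localKer_vbar_eq_bot_of_frame {d : ℤ} (hd0 : d ≠ 0) (W : WeierstrassCurve ℚ) [W.IsElliptic]
    (C : VariableChange ℚ) (hC : C • W = cm7.quadraticTwist (d : ℚ)) (hK : IsImaginaryQuadratic K)
    (v vbar : HeightOneSpectrum (𝓞 K)) (hv : ((2 : ℕ) : 𝓞 K) ∈ v.asIdeal) (hvbar : ((2 : ℕ) : 𝓞 K) ∈ vbar.asIdeal)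
    (hne : vbar ≠ v) (π : (W.baseChange K).endRing) (hrel : (π : AddMonoid.End (W.baseChange K).geomPoints) * π = π - 2)
    {r : ℤ_[2]} (hr : r * r = r - 2) (κ' : ZpExtension K 2)
    (htriv : ∀ σ ∈ κ'.kerSubgroup ⊓ decomp vbar, ∀ x : ↥((W.baseChange K).endEigenPrimaryTorsion 2 π r), σ • x = x) :
    (resOfLe ↥((W.baseChange K).endEigenPrimaryTorsion 2 π r)
        (inf_le_inf_right (decomp vbar) (le_top : κ'.kerSubgroup ≤ ⊤))).ker = ⊥ := by
  have hj : W.j = -3375 := j_eq_of_smul_eq_cm7Twist hd0 W C hC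
  obtain ⟨θ, hθ⟩ := exists_sq_eq_neg_seven_of_cmEndo_mem_endRing W K hj π hrel
  exact localKer_top_eq_bot_of_smul_eq_of_above_two W hj hK.1 hθ π hrel hr (w := vbar) (w' := v) hvbar hv hne.symm κ' htriv

end CM

end Summit.BirchSwinnertonDyer.BirchSwinnertonDyer.Theorems.PrintCf2.RestrictedSelmerPair

end
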